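import Literature.MathematicalPhysics.QuantumFieldTheory.ContinuumLimitsTrivialityAssemblyProofs
import Literature.MathematicalPhysics.QuantumLattice.Phi4BoxGaussianBounds
import HarnessLib

/-!
# Gaussian domination of the thermodynamic-limit lattice `φ⁴` laws (constructive-qft.S24)

Proofs-only companion of `ContinuumLimits.lean` / `ContinuumLimitsTrivialityAssemblyProofs.lean`
(theorems only; no statement of the tree is changed, no definition, no named fact). It joins the
`φ⁴` line built in `Literature/MathematicalPhysics/QuantumLattice/` after Aizenman–Duminil-Copin
2021, §2/§7 (block-Ising approximation of the lattice `φ⁴` measures, `GriffithsSimonApproximation`;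
the Gaussian inequality (6.3) and Newman's exponential-moment domination for `phi4Measure`,
`Phi4NewmanGaussianInequality`; their transport to the free-boundary volume measures and smeared
fields on `ℤᵈ`, `Phi4BoxGaussianBounds`) to the law-level vocabulary of the restated
`phi44_triviality` (thermodynamic limits in law `ν_δ` of
`latticeFieldLaw (phi4BoxMeasure d R g κ J) (box d R) δ ρ` as `R → ∞`), using the limit-passage
tools of the S24 assembly (`tendsto_integral_exp_eval_of_tendstoInLaw`,
`tendsto_integral_sq_eval_of_tendstoInLaw`).

## Contents (all proved)

* `latticeFieldLaw_phi4FreeMeasure_neg_rho`, `latticeFieldLaw_phi4BoxMeasure_neg_rho`: the laws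
  of the smeared field do not depend on the sign of `ρ` (evenness of the free-boundary measures).
* **`phi4_thermodynamicLimit_variance_bounded`**: along a family of box laws convergent in law
  (`R → ∞`), the variances `∫ ω(f)² d(law_R)`, `f ≥ 0`, are eventually bounded — Newman's kurtosis
  bound `⟨ω(f)⁴⟩ ≤ 3⟨ω(f)²⟩²` in each volume plus `eventually_variance_le_of_tendsto` (tightness).
* **`phi4_thermodynamicLimit_gaussianDomination`**: for `g > 0`, `J ≥ 0`, `δ ≥ 0`, real `ρ`, a limit
  in law `ν` of the box laws as `R → ∞` and a test function `f ≥ 0` at the lattice points: under `ν`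
  all exponential moments of `ω(f)` are finite, `∫ ω(f)² dν = lim_R ∫ ω(f)² d(law_R)`, and
  `∫ e^{w ω(f)} dν ≤ exp(w² ∫ ω(f)² dν / 2)` for all real `w` — unconditionally.
* `tendsto_integral_pow_eval_of_tendstoInLaw` (moments of `ω(f)` pass to limits in law under a uniform
  bound on the doubled moment — the signed truncation lemma of `GriffithsSimonApproximation` on the
  marginals) and **`phi4_thermodynamicLimit_integral_pow_le`**: in the same setting,
  `∫ ω(f)^{2m} dν ≤ (2m)!/(2^m m!) (∫ ω(f)² dν)^m` (Newman's inequality for the limit laws).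
* Signed test functions: `exists_nonneg_sub_of_hasCompactSupport` (a compactly supported test
  function is the difference of two nonnegative ones, `f = (f + Cχ) − Cχ` with a `ContDiffBump`),
  `integrable_exp_mul_eval_sub`, **`phi4_thermodynamicLimit_integrable_exp`** (all exponential
  moments of `ω(f)` under `ν`, `f` compactly supported of any sign).
* **`phi44_triviality_of_mgfDeviation`**: the S24 assembly `phi44_triviality_of_scaleBound` with its
  exponential-integrability clause discharged — what remains to be supplied for `phi44_triviality` is
  the scale `s(δ)`, the lower variance bound for one `f₀` (p. 6) and the exponential-moment deviation
  estimate of Prop. 7.2 (p. 28) for the thermodynamic-limit laws inside the window.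

## Sources

* M. Aizenman, H. Duminil-Copin, Ann. Math. 194 (2021), arXiv:1912.07973, p. 6 (the remark after
  Prop. 1.4: gaussianity from the exponential-moment estimate given the variance bounds), §7 (p. 28).
  [AizenmanDuminilCopinAnnals2021]
* C. M. Newman, Comm. Math. Phys. 41 (1975) 1–9 (Gaussian domination in the Lee–Yang / GS class), as
  vendored in `GaussianPairingBoundCouplings.lean`. [Newman1975]
-/

noncomputable section

namespace Literature.MathematicalPhysics.QuantumFieldTheory

open scoped SchwartzMap
open MeasureTheory Filter Topology
open Literature.MathematicalPhysics.QuantumLattice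
open Literature.Probability.LatticeModels (box)

variable {E : Type*} [NormedAddCommGroup E] [NormedSpace ℝ E] in
/-- **Moments pass to limits in law under a uniform bound on the doubled moment**: if `ν_i → μ` in
law on `𝒮'` (countably generated filter, probability laws eventually) and, eventually,
`∫ ω(f)^{2n} dν_i ≤ B`, then `ω(f)^n ∈ L¹(μ)` and `∫ ω(f)^n dν_i → ∫ ω(f)^n dμ` (the signed-observable
truncation lemma `tendsto_integral_of_abs_le_of_sq_integral_le` of `GriffithsSimonApproximation` on the
marginals; the case `n = 2` is `tendsto_integral_sq_eval_of_tendstoInLaw`). [folklore] -/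
theorem tendsto_integral_pow_eval_of_tendstoInLaw {ι : Type*} {l : Filter ι} [l.NeBot]
    [l.IsCountablyGenerated] {ν : ι → Measure (FieldConfig E)} {μ : Measure (FieldConfig E)}
    (hprob : ∀ᶠ i in l, IsProbabilityMeasure (ν i)) (hlim : TendstoInLaw ν l μ) (f : 𝓢(E, ℝ))
    (n : ℕ) {B : ℝ}
    (hB : ∀ᶠ i in l, Integrable (fun ω : FieldConfig E => (ω f) ^ (2 * n)) (ν i) ∧
      ∫ ω, (ω f) ^ (2 * n) ∂ν i ≤ B) :
    Integrable (fun ω : FieldConfig E => (ω f) ^ n) μ ∧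
      Tendsto (fun i => ∫ ω, (ω f) ^ n ∂ν i) l (𝓝 (∫ ω, (ω f) ^ n ∂μ)) := by
  haveI : IsProbabilityMeasure μ := isProbabilityMeasure_of_tendstoInLaw hprob hlim
  obtain ⟨P, hP⟩ := exists_probabilityMeasure_eq_map_eval ν f
  let P₀ : ProbabilityMeasure ℝ := ⟨μ.map (fun ω : FieldConfig E => ω f),
    Measure.isProbabilityMeasure_map (measurable_eval f).aemeasurable⟩
  have hP₀ : (P₀ : Measure ℝ) = μ.map (fun ω : FieldConfig E => ω f) := rfl
  have hPev : ∀ᶠ i in l, (P i : Measure ℝ) = (ν i).map (fun ω : FieldConfig E => ω f) :=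
    hprob.mono fun i hi => hP i hi
  have hconv := tendsto_marginal_of_tendstoInLaw hlim f hPev hP₀
  have hsq : ∀ x : ℝ, (|x| ^ n) ^ 2 = x ^ (2 * n) := fun x => by
    rw [← pow_mul, mul_comm, pow_mul, sq_abs, ← pow_mul]
  have hB' : ∀ᶠ i in l, Integrable (fun x : ℝ => (|x| ^ n) ^ 2) (P i : Measure ℝ) ∧
      ∫ x, (|x| ^ n) ^ 2 ∂(P i : Measure ℝ) ≤ B := by
    filter_upwards [hB, hPev] with i hi hPi
    simp_rw [hsq]
    rw [hPi, integrable_map_eval_iff (ν i) f (by fun_prop), integral_map_eval (ν i) f (by fun_prop)]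
    exact hi
  have key : ∀ u : ℕ → ι, Tendsto u atTop l →
      Integrable (fun x : ℝ => x ^ n) (P₀ : Measure ℝ) ∧
        Tendsto (fun k => ∫ x, x ^ n ∂(P (u k) : Measure ℝ)) atTop
          (𝓝 (∫ x, x ^ n ∂(P₀ : Measure ℝ))) :=
    fun u hu => tendsto_integral_of_abs_le_of_sq_integral_le (hconv.comp hu) (by fun_prop)
      (fun x => (abs_pow x n).le) (hu.eventually hB')
  obtain ⟨u₀, hu₀⟩ := l.exists_seq_tendsto
  have hint₀ := (key u₀ hu₀).1
  rw [hP₀, integrable_map_eval_iff μ f (by fun_prop)] at hint₀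
  refine ⟨hint₀, ?_⟩
  have h2 : Tendsto (fun i => ∫ x, x ^ n ∂(P i : Measure ℝ)) l
      (𝓝 (∫ x, x ^ n ∂(P₀ : Measure ℝ))) :=
    tendsto_of_seq_tendsto fun u hu => (key u hu).2
  rw [hP₀, integral_map_eval μ f (by fun_prop)] at h2
  refine h2.congr' ?_
  filter_upwards [hPev] with i hPi
  rw [hPi, integral_map_eval (ν i) f (by fun_prop)]

/-- **The law of the smeared free-boundary `φ⁴` field does not see the sign of the field
renormalisation `ρ`**: the free-boundary measures are even (`measurePreserving_neg_phi4FreeMeasure`)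
and the smearing map is odd in the configuration and in `ρ`. [folklore] -/
theorem latticeFieldLaw_phi4FreeMeasure_neg_rho {d : ℕ}
    (Λ : Finset (Literature.Probability.LatticeModels.Site d)) (g κ J δ ρ : ℝ) :
    latticeFieldLaw (phi4FreeMeasure d Λ g κ J) Λ δ (-ρ) =
      latticeFieldLaw (phi4FreeMeasure d Λ g κ J) Λ δ ρ := by
  have hcomp : (finLatticeField Λ δ (-ρ) :
      (Literature.Probability.LatticeModels.Site d → ℝ) → FieldConfig (EuclideanSpace ℝ (Fin d))) =
      finLatticeField Λ δ ρ ∘ Neg.neg := by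
    funext φ
    simp only [Function.comp_apply, finLatticeField, Pi.neg_apply, neg_mul, mul_neg]
  unfold latticeFieldLaw
  rw [hcomp, ← Measure.map_map (measurable_finLatticeField Λ δ ρ) measurable_neg,
    (measurePreserving_neg_phi4FreeMeasure d Λ g κ J).map_eq]

/-- Box form of `latticeFieldLaw_phi4FreeMeasure_neg_rho`. [folklore] -/
theorem latticeFieldLaw_phi4BoxMeasure_neg_rho {d : ℕ} (R : ℕ) (g κ J δ ρ : ℝ) :
    latticeFieldLaw (phi4BoxMeasure d R g κ J) (box d R) δ (-ρ) =
      latticeFieldLaw (phi4BoxMeasure d R g κ J) (box d R) δ ρ :=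
  latticeFieldLaw_phi4FreeMeasure_neg_rho (box d R) g κ J δ ρ

/-- **The variances of the box approximants are bounded along a convergent family** (no a-priori
input): if the laws of the smeared field under the free-boundary box measures converge in law as
`R → ∞` (`g > 0`, `J ≥ 0`, `δ ≥ 0`, any real `ρ`) then, for a test function `f ≥ 0` at the lattice
points, `∫ ω(f)² d(law_R)` is bounded for `R` large. Newman's inequality gives the kurtosis bound
`⟨ω(f)⁴⟩_R ≤ 3⟨ω(f)²⟩_R²` in every volume (`latticeFieldLaw_phi4Box_integral_pow_le`), and tight
families with bounded kurtosis have bounded variance (`eventually_variance_le_of_tendsto`: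
Paley–Zygmund plus portmanteau, from the S24 assembly). [folklore] -/
theorem phi4_thermodynamicLimit_variance_bounded {d : ℕ} {g κ J δ ρ : ℝ} (hg : 0 < g)
    (hJ : 0 ≤ J) (hδ : 0 ≤ δ) {ν : Measure (FieldConfig (EuclideanSpace ℝ (Fin d)))}
    (hν : TendstoInLaw (fun R : ℕ =>
        latticeFieldLaw (phi4BoxMeasure d R g κ J) (box d R) δ ρ) atTop ν)
    {f : 𝓢(EuclideanSpace ℝ (Fin d), ℝ)}
    (hf : ∀ x : Literature.Probability.LatticeModels.Site d, 0 ≤ f (δ • siteToE x)) :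
    ∃ B : ℝ, ∀ᶠ R : ℕ in atTop,
      ∫ ω, (ω f) ^ 2 ∂(latticeFieldLaw (phi4BoxMeasure d R g κ J) (box d R) δ ρ) ≤ B := by
  wlog hρ : 0 ≤ ρ generalizing ρ
  · have hν' : TendstoInLaw (fun R : ℕ =>
        latticeFieldLaw (phi4BoxMeasure d R g κ J) (box d R) δ (-ρ)) atTop ν := by
      simpa only [latticeFieldLaw_phi4BoxMeasure_neg_rho] using hν
    simpa only [latticeFieldLaw_phi4BoxMeasure_neg_rho] using this hν' (by linarith [le_of_not_ge hρ])
  set law : ℕ → Measure (FieldConfig (EuclideanSpace ℝ (Fin d))) := fun R =>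
    latticeFieldLaw (phi4BoxMeasure d R g κ J) (box d R) δ ρ with hlaw
  have hprobR : ∀ R : ℕ, IsProbabilityMeasure (law R) := fun R => by
    haveI := isProbabilityMeasure_phi4BoxMeasure d R hg κ J
    simp only [hlaw]
    infer_instance
  have hprob : ∀ᶠ R in atTop, IsProbabilityMeasure (law R) := Eventually.of_forall hprobR
  haveI : IsProbabilityMeasure ν := isProbabilityMeasure_of_tendstoInLaw hprob hν
  have hf' : ∀ R : ℕ, ∀ x ∈ box d R, 0 ≤ f (δ • siteToE x) := fun R x _ => hf x
  obtain ⟨P, hP⟩ := exists_probabilityMeasure_eq_map_eval law f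
  let P₀ : ProbabilityMeasure ℝ := ⟨ν.map (fun ω : FieldConfig (EuclideanSpace ℝ (Fin d)) => ω f),
    Measure.isProbabilityMeasure_map (measurable_eval f).aemeasurable⟩
  have hPev : ∀ᶠ R in atTop, (P R : Measure ℝ) =
      (law R).map (fun ω : FieldConfig (EuclideanSpace ℝ (Fin d)) => ω f) :=
    Eventually.of_forall fun R => hP R (hprobR R)
  have hconv := tendsto_marginal_of_tendstoInLaw hν f hPev (P₀ := P₀) rfl
  obtain ⟨V, hV⟩ := eventually_variance_le_of_tendsto hconv one_pos (B := 3)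
    (Eventually.of_forall fun R _ => by
      rw [hP R (hprobR R), integrable_map_eval_iff (law R) f (by fun_prop),
        integral_map_eval (law R) f (by fun_prop), integral_map_eval (law R) f (by fun_prop)]
      refine ⟨integrable_pow_eval_latticeFieldLaw_phi4FreeMeasure d (box d R) hg κ J δ ρ f 4, ?_⟩
      have h4 := latticeFieldLaw_phi4Box_integral_pow_le d R hg κ hJ hδ hρ (hf' R) 2
      norm_num [Nat.factorial] at h4
      exact h4)
  refine ⟨V, ?_⟩
  filter_upwards [hV] with R hR
  rwa [hP R (hprobR R), integral_map_eval (law R) f (by fun_prop)] at hR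

/-- **Gaussian domination of the thermodynamic-limit `φ⁴` laws.** In the setting of the restated
`phi44_triviality` at one mesh `δ ≥ 0` (any dimension `d`, `g > 0`, coupling `J ≥ 0`, any real
renormalisation `ρ` — the laws do not see its sign, `latticeFieldLaw_phi4BoxMeasure_neg_rho`): if `ν`
is a limit in law, as the box `R → ∞`, of the laws of the smeared field under the
free-boundary box measures `phi4BoxMeasure d R g κ J` and `f ≥ 0` at the lattice points, then under
`ν` (no variance bound is assumed: `phi4_thermodynamicLimit_variance_bounded`):
all exponential moments of `ω(f)` are finite; `ω(f) ∈ L²(ν)` with `∫ ω(f)² dν = lim_R ∫ ω(f)² d(law_R)`;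
and `∫ e^{w ω(f)} dν ≤ exp(w² ∫ ω(f)² dν / 2)` for all real `w`. The finite-volume inputs are Newman's
Gaussian domination `⟨e^{wω(f)}⟩_R ≤ e^{w²⟨ω(f)²⟩_R/2}` and `⟨ω(f)⁴⟩_R ≤ 3⟨ω(f)²⟩_R²`
(`Phi4BoxGaussianBounds`, from ADC's block-Ising route through the GS class), the passage to the
limit is `tendsto_integral_exp_eval_of_tendstoInLaw` / `tendsto_integral_sq_eval_of_tendstoInLaw`
of the S24 assembly. This supplies, for such `f`, the exponential-integrability clause of the
hypothesis of `phi44_triviality_of_scaleBound` unconditionally. [folklore] -/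
theorem phi4_thermodynamicLimit_gaussianDomination {d : ℕ} {g κ J δ ρ : ℝ} (hg : 0 < g)
    (hJ : 0 ≤ J) (hδ : 0 ≤ δ) {ν : Measure (FieldConfig (EuclideanSpace ℝ (Fin d)))}
    (hν : TendstoInLaw (fun R : ℕ =>
        latticeFieldLaw (phi4BoxMeasure d R g κ J) (box d R) δ ρ) atTop ν)
    {f : 𝓢(EuclideanSpace ℝ (Fin d), ℝ)} (hf : ∀ x : Literature.Probability.LatticeModels.Site d, 0 ≤ f (δ • siteToE x)) :
    (∀ w : ℝ, Integrable (fun ω : FieldConfig (EuclideanSpace ℝ (Fin d)) => Real.exp (w * ω f)) ν) ∧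
      Integrable (fun ω : FieldConfig (EuclideanSpace ℝ (Fin d)) => (ω f) ^ 2) ν ∧
      Tendsto (fun R : ℕ =>
          ∫ ω, (ω f) ^ 2 ∂(latticeFieldLaw (phi4BoxMeasure d R g κ J) (box d R) δ ρ)) atTop
        (𝓝 (∫ ω, (ω f) ^ 2 ∂ν)) ∧
      ∀ w : ℝ, ∫ ω, Real.exp (w * ω f) ∂ν ≤ Real.exp (w ^ 2 * (∫ ω, (ω f) ^ 2 ∂ν) / 2) := by
  -- the laws do not depend on the sign of `ρ`: reduce to `ρ ≥ 0`
  wlog hρ : 0 ≤ ρ generalizing ρ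
  · have hν' : TendstoInLaw (fun R : ℕ =>
        latticeFieldLaw (phi4BoxMeasure d R g κ J) (box d R) δ (-ρ)) atTop ν := by
      simpa only [latticeFieldLaw_phi4BoxMeasure_neg_rho] using hν
    have key := this hν' (by linarith [le_of_not_ge hρ])
    simpa only [latticeFieldLaw_phi4BoxMeasure_neg_rho] using key
  obtain ⟨B, hB⟩ := phi4_thermodynamicLimit_variance_bounded hg hJ hδ hν hf
  set law : ℕ → Measure (FieldConfig (EuclideanSpace ℝ (Fin d))) := fun R =>
    latticeFieldLaw (phi4BoxMeasure d R g κ J) (box d R) δ ρ with hlaw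
  have hprob : ∀ᶠ R in atTop, IsProbabilityMeasure (law R) := Eventually.of_forall fun R => by
    haveI := isProbabilityMeasure_phi4BoxMeasure d R hg κ J
    simp only [hlaw]
    infer_instance
  have hf' : ∀ R : ℕ, ∀ x ∈ box d R, 0 ≤ f (δ • siteToE x) := fun R x _ => hf x
  have hv0 : ∀ R : ℕ, 0 ≤ ∫ ω, (ω f) ^ 2 ∂(law R) := fun R => integral_nonneg fun _ => sq_nonneg _
  -- exponential moments pass to the limit
  have hexp : ∀ w : ℝ,
      Integrable (fun ω : FieldConfig (EuclideanSpace ℝ (Fin d)) => Real.exp (w * ω f)) ν ∧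
        Tendsto (fun R => ∫ ω, Real.exp (w * ω f) ∂(law R)) atTop
          (𝓝 (∫ ω, Real.exp (w * ω f) ∂ν)) := fun w =>
    tendsto_integral_exp_eval_of_tendstoInLaw hprob hν f w (B := Real.exp (2 * w ^ 2 * B))
      (hB.mono fun R hBR =>
        ⟨integrable_exp_mul_eval_latticeFieldLaw_phi4FreeMeasure d (box d R) hg κ J δ ρ f (2 * w),
          (latticeFieldLaw_phi4Box_integral_exp_mul_le d R hg κ hJ hδ hρ (hf' R) (2 * w)).trans
            (Real.exp_le_exp.2 (by nlinarith [hBR, hv0 R, sq_nonneg w]))⟩)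
  -- second moments pass to the limit (uniform fourth-moment bound `3 B²`)
  have hsq := tendsto_integral_sq_eval_of_tendstoInLaw hprob hν f (B := 3 * B ^ 2)
    (hB.mono fun R hBR => by
      refine ⟨integrable_pow_eval_latticeFieldLaw_phi4FreeMeasure d (box d R) hg κ J δ ρ f 4, ?_⟩
      have h4 := latticeFieldLaw_phi4Box_integral_pow_le d R hg κ hJ hδ hρ (hf' R) 2
      norm_num [Nat.factorial] at h4
      refine h4.trans ?_
      nlinarith [hBR, hv0 R])
  refine ⟨fun w => (hexp w).1, hsq.1, hsq.2, fun w => ?_⟩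
  refine le_of_tendsto_of_tendsto (hexp w).2
    ((Real.continuous_exp.tendsto _).comp ((hsq.2.const_mul (w ^ 2)).div_const 2))
    (Eventually.of_forall fun R => ?_)
  simp only [Function.comp_apply]
  exact latticeFieldLaw_phi4Box_integral_exp_mul_le d R hg κ hJ hδ hρ (hf' R) w

/-- **Newman's Gaussian inequality for the thermodynamic-limit `φ⁴` laws.** In the setting of
`phi4_thermodynamicLimit_gaussianDomination` (limit in law of the free-boundary box laws as `R → ∞`,
`f ≥ 0` at the lattice points), the even moments of `ω(f)` under
`ν` are Gaussian-dominated: `∫ ω(f)^{2m} dν ≤ (2m)!/(2^m m!) (∫ ω(f)² dν)^m`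
(`latticeFieldLaw_phi4Box_integral_pow_le` in each volume; the `2m`-th moments pass to the limit by
`tendsto_integral_pow_eval_of_tendstoInLaw`, the uniform bound on the `4m`-th moments being again
Newman's inequality with `phi4_thermodynamicLimit_variance_bounded`). [folklore] -/
theorem phi4_thermodynamicLimit_integral_pow_le {d : ℕ} {g κ J δ ρ : ℝ} (hg : 0 < g)
    (hJ : 0 ≤ J) (hδ : 0 ≤ δ) {ν : Measure (FieldConfig (EuclideanSpace ℝ (Fin d)))}
    (hν : TendstoInLaw (fun R : ℕ =>
        latticeFieldLaw (phi4BoxMeasure d R g κ J) (box d R) δ ρ) atTop ν)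
    {f : 𝓢(EuclideanSpace ℝ (Fin d), ℝ)}
    (hf : ∀ x : Literature.Probability.LatticeModels.Site d, 0 ≤ f (δ • siteToE x)) (m : ℕ) :
    Integrable (fun ω : FieldConfig (EuclideanSpace ℝ (Fin d)) => (ω f) ^ (2 * m)) ν ∧
      ∫ ω, (ω f) ^ (2 * m) ∂ν ≤
        ((2 * m).factorial : ℝ) / (2 ^ m * m.factorial) * (∫ ω, (ω f) ^ 2 ∂ν) ^ m := by
  wlog hρ : 0 ≤ ρ generalizing ρ
  · have hν' : TendstoInLaw (fun R : ℕ =>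
        latticeFieldLaw (phi4BoxMeasure d R g κ J) (box d R) δ (-ρ)) atTop ν := by
      simpa only [latticeFieldLaw_phi4BoxMeasure_neg_rho] using hν
    exact this hν' (by linarith [le_of_not_ge hρ])
  obtain ⟨B, hB⟩ := phi4_thermodynamicLimit_variance_bounded hg hJ hδ hν hf
  set law : ℕ → Measure (FieldConfig (EuclideanSpace ℝ (Fin d))) := fun R =>
    latticeFieldLaw (phi4BoxMeasure d R g κ J) (box d R) δ ρ with hlaw
  have hprob : ∀ᶠ R in atTop, IsProbabilityMeasure (law R) := Eventually.of_forall fun R => by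
    haveI := isProbabilityMeasure_phi4BoxMeasure d R hg κ J
    simp only [hlaw]
    infer_instance
  have hf' : ∀ R : ℕ, ∀ x ∈ box d R, 0 ≤ f (δ • siteToE x) := fun R x _ => hf x
  have hv0 : ∀ R : ℕ, 0 ≤ ∫ ω, (ω f) ^ 2 ∂(law R) := fun R => integral_nonneg fun _ => sq_nonneg _
  -- the `2m`-th moments pass to the limit: uniform bound on the `4m`-th moments
  have hpow := tendsto_integral_pow_eval_of_tendstoInLaw hprob hν f (2 * m)
    (B := ((2 * (2 * m)).factorial : ℝ) / (2 ^ (2 * m) * (2 * m).factorial) * B ^ (2 * m))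
    (hB.mono fun R hBR => by
      refine ⟨integrable_pow_eval_latticeFieldLaw_phi4FreeMeasure d (box d R) hg κ J δ ρ f _, ?_⟩
      refine (latticeFieldLaw_phi4Box_integral_pow_le d R hg κ hJ hδ hρ (hf' R) (2 * m)).trans ?_
      exact mul_le_mul_of_nonneg_left (pow_le_pow_left₀ (hv0 R) hBR _) (by positivity))
  have hvar := (phi4_thermodynamicLimit_gaussianDomination hg hJ hδ hν hf).2.2.1
  refine ⟨hpow.1, le_of_tendsto_of_tendsto hpow.2 ((hvar.pow m).const_mul _)
    (Eventually.of_forall fun R => ?_)⟩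
  exact latticeFieldLaw_phi4Box_integral_pow_le d R hg κ hJ hδ hρ (hf' R) m

/-! ### Signed test functions and the integrability clause of `phi44_triviality_of_scaleBound` -/

section Signed

variable {E' : Type*} [NormedAddCommGroup E'] [InnerProductSpace ℝ E'] [FiniteDimensional ℝ E']

/-- **A compactly supported test function is a difference of two nonnegative ones**:
`f = (f + Cχ) − Cχ` with `C = sup |f|` and `χ` a smooth bump equal to `1` on the support of `f`
(Mathlib `ContDiffBump`, `HasCompactSupport.toSchwartzMap`). [folklore] -/
theorem exists_nonneg_sub_of_hasCompactSupport (f : 𝓢(E', ℝ)) (hf : HasCompactSupport f) :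
    ∃ f₁ f₂ : 𝓢(E', ℝ), HasCompactSupport f₁ ∧ HasCompactSupport f₂ ∧ (∀ x, 0 ≤ f₁ x) ∧
      (∀ x, 0 ≤ f₂ x) ∧ ∀ x, f x = f₁ x - f₂ x := by
  obtain ⟨R, hR⟩ := hf.isCompact.isBounded.subset_closedBall (0 : E')
  let b : ContDiffBump (0 : E') := ⟨max R 0 + 1, max R 0 + 2, by positivity, by linarith⟩
  set C : ℝ := SchwartzMap.seminorm ℝ 0 0 f with hC_def
  have hC : ∀ x, |f x| ≤ C := fun x => by
    simpa [Real.norm_eq_abs] using SchwartzMap.norm_le_seminorm ℝ f x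
  have hC0 : 0 ≤ C := (abs_nonneg _).trans (hC 0)
  set χ : 𝓢(E', ℝ) := b.hasCompactSupport.toSchwartzMap b.contDiff with hχ_def
  have hχ : ∀ x, χ x = b x := fun x => rfl
  have hcoe₂ : ⇑(C • χ) = fun x => C * b x := by
    funext x
    simp [hχ]
  have hcoe₁ : ⇑(f + C • χ) = ⇑f + fun x => C * b x := by
    funext x
    simp [hχ]
  refine ⟨f + C • χ, C • χ, ?_, ?_, ?_, ?_, ?_⟩
  · rw [hcoe₁]
    exact hf.add b.hasCompactSupport.mul_left
  · rw [hcoe₂]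
    exact b.hasCompactSupport.mul_left
  · intro x
    simp only [add_apply, smul_apply, smul_eq_mul, hχ]
    by_cases hx : x ∈ tsupport f
    · have hx1 : b x = 1 := b.one_of_mem_closedBall (by
        have h := hR hx
        simp only [Metric.mem_closedBall] at h ⊢
        change dist x 0 ≤ max R 0 + 1
        linarith [le_max_left R 0])
      rw [hx1, mul_one]
      linarith [neg_abs_le (f x), hC x]
    · have hfx : f x = 0 := image_eq_zero_of_notMem_tsupport hx
      rw [hfx, zero_add]
      exact mul_nonneg hC0 (b.nonneg' x)
  · intro x
    simp only [smul_apply, smul_eq_mul, hχ]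
    exact mul_nonneg hC0 (b.nonneg' x)
  · intro x
    simp only [add_apply, smul_apply, smul_eq_mul]
    ring

variable {E : Type*} [NormedAddCommGroup E] [NormedSpace ℝ E] in
/-- Exponential integrability of `ω(f₁ − f₂)` from that of `ω(f₁)` and `ω(f₂)`
(`e^{w(a−b)} ≤ (e^{2wa} + e^{−2wb})/2`). [folklore] -/
theorem integrable_exp_mul_eval_sub (ν : Measure (FieldConfig E)) (f₁ f₂ : 𝓢(E, ℝ))
    (h₁ : ∀ w : ℝ, Integrable (fun ω : FieldConfig E => Real.exp (w * ω f₁)) ν)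
    (h₂ : ∀ w : ℝ, Integrable (fun ω : FieldConfig E => Real.exp (w * ω f₂)) ν) (w : ℝ) :
    Integrable (fun ω : FieldConfig E => Real.exp (w * ω (f₁ - f₂))) ν := by
  have hdom := ((h₁ (2 * w)).add (h₂ (-(2 * w)))).div_const 2
  refine hdom.mono'
    ((Real.continuous_exp.measurable.comp ((measurable_eval (f₁ - f₂)).const_mul w)).aestronglyMeasurable)
    (Eventually.of_forall fun ω => ?_)
  rw [Real.norm_eq_abs, abs_of_pos (Real.exp_pos _), map_sub, mul_sub, Real.exp_sub]
  have ha := Real.exp_pos (w * ω f₁)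
  have hb := Real.exp_pos (w * ω f₂)
  have h2a : Real.exp (2 * w * ω f₁) = Real.exp (w * ω f₁) ^ 2 := by
    rw [sq, ← Real.exp_add]; ring_nf
  have h2b : Real.exp (-(2 * w) * ω f₂) = (Real.exp (w * ω f₂))⁻¹ ^ 2 := by
    rw [sq, ← Real.exp_neg, ← Real.exp_add]; ring_nf
  simp only [Pi.add_apply, h2a, h2b]
  rw [div_le_div_iff₀ hb two_pos]
  have hinv : (Real.exp (w * ω f₂))⁻¹ * Real.exp (w * ω f₂) = 1 := inv_mul_cancel₀ hb.ne'
  nlinarith [sq_nonneg (Real.exp (w * ω f₁) * Real.exp (w * ω f₂) - 1),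
    sq_nonneg ((Real.exp (w * ω f₂))⁻¹), mul_pos ha hb, hinv,
    sq_nonneg (Real.exp (w * ω f₁) - (Real.exp (w * ω f₂))⁻¹)]

/-- **All exponential moments of the thermodynamic-limit `φ⁴` field, for signed test functions.**
In the setting of `phi4_thermodynamicLimit_gaussianDomination` (any thermodynamic limit in law of the
free-boundary box laws, `g > 0`, `J ≥ 0`, `δ ≥ 0`), for every compactly supported test function `f`
of any sign and every real `w`, `e^{w ω(f)} ∈ L¹(ν)`
(`exists_nonneg_sub_of_hasCompactSupport`, `integrable_exp_mul_eval_sub`). [folklore] -/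
theorem phi4_thermodynamicLimit_integrable_exp {d : ℕ} {g κ J δ ρ : ℝ} (hg : 0 < g) (hJ : 0 ≤ J)
    (hδ : 0 ≤ δ) {ν : Measure (FieldConfig (EuclideanSpace ℝ (Fin d)))}
    (hν : TendstoInLaw (fun R : ℕ =>
        latticeFieldLaw (phi4BoxMeasure d R g κ J) (box d R) δ ρ) atTop ν)
    (f : 𝓢(EuclideanSpace ℝ (Fin d), ℝ)) (hf : HasCompactSupport f) (w : ℝ) :
    Integrable (fun ω : FieldConfig (EuclideanSpace ℝ (Fin d)) => Real.exp (w * ω f)) ν := by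
  obtain ⟨f₁, f₂, -, -, h₁, h₂, hsub⟩ := exists_nonneg_sub_of_hasCompactSupport f hf
  have e : f = f₁ - f₂ := by
    ext x
    simp [hsub x]
  have i₁ := (phi4_thermodynamicLimit_gaussianDomination hg hJ hδ hν (f := f₁) (fun x => h₁ _)).1
  have i₂ := (phi4_thermodynamicLimit_gaussianDomination hg hJ hδ hν (f := f₂) (fun x => h₂ _)).1
  rw [e]
  exact integrable_exp_mul_eval_sub ν f₁ f₂ i₁ i₂ w

end Signed

/-! ### `phi44_triviality` from the exponential-moment deviation estimate (ADC Prop. 7.2) -/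

section Reduction

open Literature.Probability.LatticeModels (invCorrLength)

/-- **`phi44_triviality` from ADC Prop. 7.2 alone (with the scale and the lower variance bound):**
the S24 assembly `phi44_triviality_of_scaleBound` with its exponential-integrability clause
discharged (`phi4_thermodynamicLimit_integrable_exp`: every thermodynamic limit in law of the
free-boundary lattice `φ⁴` box laws has all exponential moments, by Newman's Gaussian domination along
Aizenman–Duminil-Copin's block-Ising route through the GS class and the tightness of a convergent
family). What remains as hypothesis, for the laws `ν_δ` of the restated `phi44_triviality` inside its
window, is exactly the printed quantitative input: a scale `s(δ) ≥ 0`, the lower variance bound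
`c s(δ) ≤ ∫ ω(f₀)² dν_δ` for one compactly supported `f₀` (p. 6), and for every compactly supported `f`
the exponential-moment deviation estimate `|∫ e^{wω(f)} dν_δ − e^{w² v_δ(f)/2}| ≤ K(δ) G(s(δ) w²)` with
`K → 0` and `G` monotone (Prop. 7.2, p. 28, in the form its proof gives, §6.3). [cite: AizenmanDuminilCopinAnnals2021, Thm 1.2 (p. 4) via Prop. 7.2 (p. 28), §6.3 (p. 26) and p. 6] -/
theorem phi44_triviality_of_mgfDeviation
    (h : ∀ (g κ : ℝ), 0 < g → ∀ (J : ℝ → ℝ) (ρ : ℝ → ℝ)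
      (ν : ℝ → Measure (FieldConfig (EuclideanSpace ℝ (Fin 4)))),
      (∀ δ, 0 < δ → 0 ≤ J δ ∧ J δ ≤ phi4CriticalJ 4 g κ) →
      (∃ M : ℝ, ∀ᶠ δ in 𝓝[>] (0 : ℝ), J δ = phi4CriticalJ 4 g κ ∨
          (0 < J δ ∧ invCorrLength (phi4TwoPoint 4 g κ (J δ)) ≤ M * δ)) →
      (∀ δ, 0 < δ → TendstoInLaw (fun R : ℕ =>
          latticeFieldLaw (phi4BoxMeasure 4 R g κ (J δ)) (box 4 R) δ (ρ δ)) atTop (ν δ)) →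
      ∃ s : ℝ → ℝ, (∀ᶠ δ in 𝓝[>] (0 : ℝ), 0 ≤ s δ) ∧
        (∃ (f₀ : 𝓢(EuclideanSpace ℝ (Fin 4), ℝ)) (c : ℝ), HasCompactSupport f₀ ∧ 0 < c ∧
          ∀ᶠ δ in 𝓝[>] (0 : ℝ), c * s δ ≤ ∫ ω, (ω f₀) ^ 2 ∂ν δ) ∧
        ∀ f : 𝓢(EuclideanSpace ℝ (Fin 4), ℝ), HasCompactSupport f →
          ∃ (K : ℝ → ℝ) (G : ℝ → ℝ), Tendsto K (𝓝[>] 0) (𝓝 0) ∧ MonotoneOn G (Set.Ici 0) ∧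
            ∀ᶠ δ in 𝓝[>] (0 : ℝ), ∀ w : ℝ,
              |(∫ ω, Real.exp (w * ω f) ∂ν δ) -
                  Real.exp (w ^ 2 * (∫ ω, (ω f) ^ 2 ∂ν δ) / 2)| ≤ K δ * G (s δ * w ^ 2)) :
    phi44_triviality := by
  refine phi44_triviality_of_scaleBound fun g κ hg J ρ ν hJ hM hν => ?_
  obtain ⟨s, hs, h₀, hf⟩ := h g κ hg J ρ ν hJ hM hν
  refine ⟨s, hs, h₀, fun f hfc => ?_⟩
  obtain ⟨K, G, hK, hG, hbd⟩ := hf f hfc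
  refine ⟨K, G, hK, hG, ?_, hbd⟩
  filter_upwards [self_mem_nhdsWithin] with δ hδ
  intro w
  exact phi4_thermodynamicLimit_integrable_exp hg (hJ δ hδ).1 (le_of_lt hδ) (hν δ hδ) f hfc w

end Reduction

end Literature.MathematicalPhysics.QuantumFieldTheory

end
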